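import Mathlib
import HarnessLib
import Summits.HubbardSuperconductivity.HubbardSuperconductivity.Theorems.KLProgrammeC4aAbsBubbleNonCooper
import Summits.HubbardSuperconductivity.HubbardSuperconductivity.Theorems.KLProgrammeC4aPartnerBandLevelRate
import Summits.HubbardSuperconductivity.HubbardSuperconductivity.Theorems.KLProgrammeC4aLoopChordBounds
import Summits.HubbardSuperconductivity.HubbardSuperconductivity.Theorems.KLProgrammeC4aLevelDensityRadialVertex
import Summits.HubbardSuperconductivity.HubbardSuperconductivity.Theorems.KLProgrammeC4aFoldValueDrift

/-!
# Route `KLProgramme` — crux C4a, S3 brick (B4) «(U1)-LAWS» part 3: the ACTUAL PARTNER BAND IS A FOLD-BOX FAMILY — from ONE datum, the caustic distance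
# `dist₀ = ‖S − 2πm − 2Φ(0, x₀+θ)‖` at the reference loop angle, the band `e ↦ (y ↦ e_K(S − Φ(e, y+θ)))` has on the box `[−hi, hi] × [α, β]` a fold point at every
# level (IVT, no implicit function), the curvature floor/ceiling, and the fold-value drift at rates in `[1/2, 3/2]` (monotonicity of the minimum)

Cell `gate-hubbard-kl`, seat hubbard-kl-k3c3-p3 (g31; row «implicit-function / monotonicity route for μ(n)»).  Located brick for the (C)-closer lane / the (M4)
assembly of the umklapp first-order ϑ-layer (stub (C) `stub_twoLeg_curvature` of `KLRegimeEngineV17F2`, stmt-HubbardSuperconductivity-20437), memo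
HOME/hubbard-kl-k3c3-p3/U1-CAUSTIC-SUP.md §11.  Parts 1–2 (`…C4aFoldBoxTwoSidedLaw`, `…C4aFoldBoxPostLaw`) compose the first-order laws for an ABSTRACT fold-box
family (bands `g e`, fold points `v*(e)`, floor `c₂`, ceiling `L₂`, height `G`, drift `δ₀ − λ₂e ≤ g e (v* e) ≤ δ₀ − λ₁e`).  This file shows that the partner band of a
configuration with pair sum `S` (sheet `m`, base angle `θ`), `g e y = e_K(S − Φ(e, y + θ))`, IS such a family on any box `|e| ≤ hi`, `y ∈ [α, β] ∋ x₀` that is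
close to the caustic of the sheet `m` — closeness measured by the single number `dist₀ = ‖S − 2πm − 2Φ(0, x₀ + θ)‖` plus the box size (`hi`, `Wφ ≥ |y − x₀|`):
* §1 (carrier-free) **`exists_foldPoint_of_slope_small`** (`g ∈ C²`, floor `c₂ > 0` on `[α,β] ∋ x₀`, `|g′(x₀)| ≤ c₂·min(x₀ − α, β − x₀)` ⟹ a critical point in
  `[α,β]` — IVT on the increasing slope; NO implicit function), **`sInf_image_eq_of_fold`** (the fold value is the window infimum).
* §2 (sizes) **`abs_deriv_partnerBand_angle_le_caustic`**: `|∂_y e_K(S − Φ(e,y+θ))| ≤ K₂·msD₁·‖S − 2πm − 2Φ(e,y+θ)‖` — the loop slope is small EXACTLY near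
  the caustic (tangent annihilation `De_K(Φ)[∂Φ] = 0` + periodicity + the `K₂`-Lipschitz row of `De_K`; the loop-direction twin of
  `…C4aPartnerBandLevelRate.abs_deriv_partnerBand_level_add_one_le`); **`norm_caustic_sub_two_smul_le`**: the caustic distance moves by at most
  `2(|e|/(Dt−2A) + msD₁|y − x₀|)` over the box.
* §3 **`partnerBand_curvature_of_window`** (floor `c₂ = w·u_min²` and ceiling `L₂ = 2K₂msD₁² + w·u_min²` from `…C4aAbsBubbleFoldSheet` under the window hypothesis
  `L ≤ w·u_min²`, pointwise as in `level_loop_partnerBand_le_fold`); **`exists_foldPoints_partnerBand`** (fold points `v*(e) ∈ [α,β]` at EVERY level `|e| ≤ hi`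
  from `K₂msD₁(dist₀ + 2hi/(Dt−2A)) ≤ c₂·W_m`, `W_m` the margin of `x₀` in the window); **`partnerBand_foldValue_drift`** (for ANY choice of fold points:
  `δ₀ − (3/2)e ≤ g e (v* e) ≤ δ₀ − (1/2)e` for `0 ≤ e ≤ hi` and the mirror form `−δ₀ − (3/2)s ≤ −g (−s) (v*(−s)) ≤ −δ₀ − (1/2)s` for the negative levels, with
  `δ₀ = g 0 (v* 0) = inf_{[α,β]} g 0` — from the rate window `K₂(dist₀ + 2(hi/(Dt−2A) + msD₁Wφ))/(Dt−2A) ≤ 1/2` via `…C4aPartnerBandLevelRate.partnerBand_level_rate_window`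
  and the minimiser comparison of `…C4aFoldValueDrift` — monotonicity of the minimum, no implicit function).
Sizes binder shape of `…C4aAbsBubbleFoldSheet` + `GeomConstants` (= `FrameOK` (i)); nothing about the model's sizes beyond that; nothing asserts (C), K3 or
superconductivity.  References: Salmhofer 1999 §4.5.3 [cite: Salmhofer1999]; FST II CPAM 51 (1998) Lemma 2.1, §3 [cite: FeldmanSalmhoferTrubowitz1998].
-/

noncomputable section

namespace Summit.HubbardSuperconductivity.HubbardSuperconductivity.Theorems.C4a

set_option linter.dupNamespace false -- summit = problem name (single-conjunct summit), D-0017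

open Real Set
open Literature.MathematicalPhysics.QuantumLattice Literature.MathematicalPhysics.QuantumLattice.BandSectorCounting
open Literature.MathematicalPhysics.QuantumLattice.FermiRG
open Summit.HubbardSuperconductivity.HubbardSuperconductivity.Theorems.KLRegimeSplit
open Summit.HubbardSuperconductivity.HubbardSuperconductivity.Theorems.DispersionFlow
open Summit.HubbardSuperconductivity.HubbardSuperconductivity.Theorems.PerturbedFermiCurve

/-! ## §1 Carrier-free: a fold point from a small slope; the fold value is the window infimum -/

/-- **A FOLD POINT FROM A SMALL SLOPE (IVT, no implicit function).**  `g ∈ C²` with `c₂ ≤ g″` on `[α,β] ∋ x₀` (`c₂ > 0`) and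
`|g′(x₀)| ≤ c₂(x₀ − α)`, `|g′(x₀)| ≤ c₂(β − x₀)` ⟹ `g′(α) ≤ 0 ≤ g′(β)`, so `g′` vanishes somewhere in `[α,β]`. -/
theorem exists_foldPoint_of_slope_small {g : ℝ → ℝ} {α β x₀ c₂ : ℝ} (hg : ContDiff ℝ 2 g) (hx₀ : x₀ ∈ Icc α β)
    (hfloor : ∀ v ∈ Icc α β, c₂ ≤ iteratedDeriv 2 g v) (hα : |deriv g x₀| ≤ c₂ * (x₀ - α)) (hβ : |deriv g x₀| ≤ c₂ * (β - x₀)) :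
    ∃ vs ∈ Icc α β, deriv g vs = 0 := by
  have hdg : Differentiable ℝ (deriv g) := by
    have h : Differentiable ℝ (iteratedDeriv 1 g) := ContDiff.differentiable_iteratedDeriv 1 hg (by norm_num)
    rwa [iteratedDeriv_one] at h
  have hd2 : ∀ x, deriv (deriv g) x = iteratedDeriv 2 g x := fun x => by
    rw [show iteratedDeriv 2 g = deriv (iteratedDeriv 1 g) from iteratedDeriv_succ, iteratedDeriv_one]
  have hcont : ContinuousOn (deriv g) (Icc α β) := hdg.continuous.continuousOn
  have hincr : ∀ a b : ℝ, α ≤ a → a ≤ b → b ≤ β → c₂ * (b - a) ≤ deriv g b - deriv g a := fun a b ha hab hb =>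
    (convex_Icc α β).mul_sub_le_image_sub_of_le_deriv hcont (hdg.differentiableOn.mono interior_subset)
      (fun x hx => by rw [hd2]; exact hfloor x (interior_subset hx)) a ⟨ha, hab.trans hb⟩ b ⟨ha.trans hab, hb⟩ hab
  have h1 : deriv g α ≤ 0 := by
    have := hincr α x₀ le_rfl hx₀.1 hx₀.2
    have := (abs_le.1 hα).2
    linarith
  have h2 : 0 ≤ deriv g β := by
    have := hincr x₀ β hx₀.1 hx₀.2 le_rfl
    have := (abs_le.1 hβ).1
    linarith
  obtain ⟨vs, hvs, h0⟩ := intermediate_value_Icc (hx₀.1.trans hx₀.2) hcont ⟨h1, h2⟩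
  exact ⟨vs, hvs, h0⟩

/-- **The fold value is the window infimum**: `g ∈ C²`, `0 ≤ g″` on `[α,β] ∋ v*`, `g′(v*) = 0` ⟹ `inf_{[α,β]} g = g(v*)`. -/
theorem sInf_image_eq_of_fold {g : ℝ → ℝ} {α β vs : ℝ} (hg : ContDiff ℝ 2 g) (hvs : vs ∈ Icc α β) (hcrit : deriv g vs = 0)
    (hconv : ∀ v ∈ Icc α β, 0 ≤ iteratedDeriv 2 g v) : sInf (g '' Icc α β) = g vs := by
  have hleast : IsLeast (g '' Icc α β) (g vs) :=
    ⟨⟨vs, hvs, rfl⟩, fun y ⟨v, hv, hy⟩ => hy ▸ le_of_fold_of_convex hg hvs hcrit hconv hv⟩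
  exact hleast.csInf_eq

/-! ## §2 The loop slope and the caustic distance over the box -/

section Sizes

variable {K : TrigPolyC4v} {A : ℝ} (hA : ∀ p : Momentum, ∀ j ≤ 2, ‖iteratedFDeriv ℝ j (frameShift K) p‖ ≤ A) (hA20 : A ≤ 1 / 20)
  (hd : klCurveD ≤ (bandBounds (show (-4 : ℝ) < -1.1 by norm_num) (show (-1.1 : ℝ) ≤ -0.1 by norm_num)
    (show (-0.1 : ℝ) < 0 by norm_num)).Dtmin - 2 * A)
  {μ r : ℝ} (hr : 0 < r) (hlo : (-1.1 : ℝ) < μ - r - A) (hhi : μ + r + A < -0.1)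
  {A₃ A₄ : ℝ} (hA₃ : ∀ p : Momentum, ‖iteratedFDeriv ℝ 3 (frameShift K) p‖ ≤ A₃)
  (hA₄ : ∀ p : Momentum, ‖iteratedFDeriv ℝ 4 (frameShift K) p‖ ≤ A₄)
  {K₁ K₂ K₃ : ℝ} (hK₁ : ∀ p : Momentum, ‖fderiv ℝ (frameLevel μ K) p‖ ≤ K₁) (hK₂ : ∀ p : Momentum, ‖iteratedFDeriv ℝ 2 (frameLevel μ K) p‖ ≤ K₂)
  (hK₃ : ∀ p : Momentum, ‖iteratedFDeriv ℝ 3 (frameLevel μ K) p‖ ≤ K₃)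
include hA hA20 hd hr hlo hhi hA₃ hA₄ hK₁ hK₂ hK₃

omit hr hK₁ hK₃ in
/-- **THE LOOP SLOPE IS SMALL NEAR THE CAUSTIC**: `|∂_y e_K(S − Φ(e, y+θ))| ≤ K₂·msD₁·‖S − 2πm − 2Φ(e, y+θ)‖` (`|e| < r`, any sheet `m`).
(`∂_y = −De_K(S − Φ)[∂Φ]`; `De_K(Φ(e,·))[∂Φ(e,·)] = 0` since `e_K ∘ Φ(e,·) ≡ e`; `De_K` is `2πℤ²`-periodic and `K₂`-Lipschitz; `‖∂Φ‖ ≤ msD₁`.) -/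
theorem abs_deriv_partnerBand_angle_le_caustic (S : Momentum) (m : Fin 2 → ℤ) {e : ℝ} (he : |e| < r) (θ y : ℝ) :
    |deriv (fun x : ℝ => frameLevel μ K (S - levelPoint μ K e (x + θ))) y| ≤
      K₂ * msD A₃ A₄ 1 * ‖S - WithLp.toLp 2 (fun i => 2 * π * (m i : ℝ)) - (2 : ℝ) • levelPoint μ K e (y + θ)‖ := by
  set B₀ := bandBounds (show (-4 : ℝ) < -1.1 by norm_num) (show (-1.1 : ℝ) ≤ -0.1 by norm_num) (show (-0.1 : ℝ) < 0 by norm_num) with hB₀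
  set v : Momentum := WithLp.toLp 2 (fun i => 2 * π * (m i : ℝ)) with hv
  set p : Momentum := levelPoint μ K e (y + θ) with hp
  set τ : Momentum := iteratedDeriv 1 (levelPoint μ K e) (y + θ) with hτ
  have h1 : (-1.1 : ℝ) ≤ μ + e - A := by have := (abs_lt.1 he).1; linarith
  have h2 : μ + e + A ≤ -0.1 := by have := (abs_lt.1 he).2; linarith
  have hE : ∀ q : Momentum, HasFDerivAt (frameLevel μ K) (fderiv ℝ (frameLevel μ K) q) q := fun q =>
    (((EngineV8.contDiff_frameLevel μ K (n := 1)).differentiable one_ne_zero) q).hasFDerivAt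
  have hq : HasDerivAt (fun x : ℝ => levelPoint μ K e (x + θ)) τ y :=
    HasDerivAt.comp_add_const y θ (hasDerivAt_levelPoint_angle hA hd hlo hhi he (y + θ))
  have hder : HasDerivAt (fun x : ℝ => frameLevel μ K (S - levelPoint μ K e (x + θ))) (fderiv ℝ (frameLevel μ K) (S - p) (-τ)) y := by
    have hS : HasDerivAt (fun x : ℝ => S - levelPoint μ K e (x + θ)) (-τ) y := by
      have h := hq.const_sub S
      simpa using h
    exact (hE (S - p)).comp_hasDerivAt y hS
  rw [hder.deriv]
  -- tangent annihilation
  have htan : fderiv ℝ (frameLevel μ K) p τ = 0 := by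
    have ha : HasDerivAt (frameLevel μ K ∘ levelPoint μ K e) (fderiv ℝ (frameLevel μ K) p τ) (y + θ) :=
      (hE p).comp_hasDerivAt (y + θ) (hasDerivAt_levelPoint_angle hA hd hlo hhi he (y + θ))
    have hb : HasDerivAt (frameLevel μ K ∘ levelPoint μ K e) 0 (y + θ) := by
      have hconst : (frameLevel μ K ∘ levelPoint μ K e) = fun _ => e :=
        funext fun s => frameLevel_levelPoint B₀ hA h1 h2 s
      rw [hconst]; exact hasDerivAt_const _ _
    exact ha.unique hb
  -- periodicity of `De_K`
  have hper : fderiv ℝ (frameLevel μ K) (S - p) = fderiv ℝ (frameLevel μ K) (S - p - v) := by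
    have h := fderiv_frameLevel_add_period μ K (frameLevel_add_twoPi μ K m) (S - p - v)
    rw [sub_add_cancel] at h
    exact h
  have hK₂0 : 0 ≤ K₂ := (norm_nonneg _).trans (hK₂ 0)
  have hτn : ‖τ‖ ≤ msD A₃ A₄ 1 := norm_iteratedDeriv_levelPoint_le hA hA20 hd hlo hhi hA₃ hA₄ he le_rfl (by norm_num) _
  have hexpr : fderiv ℝ (frameLevel μ K) (S - p) (-τ) = -((fderiv ℝ (frameLevel μ K) (S - p - v) - fderiv ℝ (frameLevel μ K) p) τ) := by
    rw [map_neg, hper, _root_.sub_apply, htan, sub_zero]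
  rw [hexpr, abs_neg, ← Real.norm_eq_abs]
  calc ‖(fderiv ℝ (frameLevel μ K) (S - p - v) - fderiv ℝ (frameLevel μ K) p) τ‖
      ≤ ‖fderiv ℝ (frameLevel μ K) (S - p - v) - fderiv ℝ (frameLevel μ K) p‖ * ‖τ‖ := ContinuousLinearMap.le_opNorm _ _
    _ ≤ K₂ * ‖S - p - v - p‖ * msD A₃ A₄ 1 := mul_le_mul (norm_fderiv_frameLevel_sub_le hK₂ _ _) hτn (norm_nonneg _) (by positivity)
    _ = K₂ * msD A₃ A₄ 1 * ‖S - v - (2 : ℝ) • p‖ := by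
        rw [show S - p - v - p = S - v - (2 : ℝ) • p by rw [two_smul]; abel]; ring

omit hr hK₁ hK₂ hK₃ in
/-- **The caustic distance over the box**: `‖S − v − 2Φ(e, y+θ)‖ ≤ ‖S − v − 2Φ(0, x₀+θ)‖ + 2(|e|/(Dt−2A) + msD₁|y − x₀|)` (`|e| < r`; radial row + angular
mean value). -/
theorem norm_caustic_sub_two_smul_le (S v : Momentum) {e : ℝ} (he : |e| < r) (θ x₀ y : ℝ) :
    ‖S - v - (2 : ℝ) • levelPoint μ K e (y + θ)‖ ≤
      ‖S - v - (2 : ℝ) • levelPoint μ K 0 (x₀ + θ)‖ +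
        2 * (|e| / ((bandBounds (show (-4 : ℝ) < -1.1 by norm_num) (show (-1.1 : ℝ) ≤ -0.1 by norm_num) (show (-0.1 : ℝ) < 0 by norm_num)).Dtmin - 2 * A) +
          msD A₃ A₄ 1 * |y - x₀|) := by
  set B := bandBounds (show (-4 : ℝ) < -1.1 by norm_num) (show (-1.1 : ℝ) ≤ -0.1 by norm_num) (show (-0.1 : ℝ) < 0 by norm_num) with hBdef
  have hADt : 2 * A < B.Dtmin := by have := klCurveD_pos; linarith
  have hr' : 0 < r := lt_of_le_of_lt (abs_nonneg e) he
  have h0 : |(0 : ℝ)| < r := by simpa using hr'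
  have heI : e ∈ Ioo (-r) r := ⟨(abs_lt.1 he).1, (abs_lt.1 he).2⟩
  have h0I : (0 : ℝ) ∈ Ioo (-r) r := ⟨by linarith, hr'⟩
  have hrad : ‖levelPoint μ K e (y + θ) - levelPoint μ K 0 (y + θ)‖ ≤ |e| / (B.Dtmin - 2 * A) := by
    have h := norm_levelPoint_sub_levelPoint_le B hA hADt hlo hhi heI h0I (y + θ)
    rwa [sub_zero] at h
  have hang : ‖levelPoint μ K 0 (y + θ) - levelPoint μ K 0 (x₀ + θ)‖ ≤ msD A₃ A₄ 1 * |y - x₀| := by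
    have h := norm_levelPoint_sub_le_abs hA hA20 hd hlo hhi hA₃ hA₄ h0 (y + θ) (x₀ + θ)
    rwa [show y + θ - (x₀ + θ) = y - x₀ by ring] at h
  have hsplit : S - v - (2 : ℝ) • levelPoint μ K e (y + θ) =
      (S - v - (2 : ℝ) • levelPoint μ K 0 (x₀ + θ)) - (2 : ℝ) • (levelPoint μ K e (y + θ) - levelPoint μ K 0 (x₀ + θ)) := by
    rw [smul_sub]; abel
  rw [hsplit]
  calc ‖S - v - (2 : ℝ) • levelPoint μ K 0 (x₀ + θ) - (2 : ℝ) • (levelPoint μ K e (y + θ) - levelPoint μ K 0 (x₀ + θ))‖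
      ≤ ‖S - v - (2 : ℝ) • levelPoint μ K 0 (x₀ + θ)‖ + ‖(2 : ℝ) • (levelPoint μ K e (y + θ) - levelPoint μ K 0 (x₀ + θ))‖ := norm_sub_le _ _
    _ ≤ ‖S - v - (2 : ℝ) • levelPoint μ K 0 (x₀ + θ)‖ + 2 * (|e| / (B.Dtmin - 2 * A) + msD A₃ A₄ 1 * |y - x₀|) := by
        rw [norm_smul, Real.norm_eq_abs, abs_two]
        have := norm_sub_le_norm_sub_add_norm_sub (levelPoint μ K e (y + θ)) (levelPoint μ K 0 (y + θ)) (levelPoint μ K 0 (x₀ + θ))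
        nlinarith [hrad, hang, norm_nonneg (levelPoint μ K e (y + θ) - levelPoint μ K 0 (x₀ + θ))]

/-! ## §3 The fold box of the partner band: curvature, fold points, drift -/

/-- **CURVATURE FLOOR AND CEILING ON THE BOX** (`GeomConstants`; sheet `m`, reference loop angle `x₀`): wherever p623173's modulus at
(`‖S − 2πm − 2Φ(0,x₀+θ)‖`, `|e|`, `|y − x₀|`) is `≤ w·u_min²` (the pointwise window hypothesis of `…C4aAbsBubbleFoldSheet.level_loop_partnerBand_le_fold`),
`c₂ := w·u_min² ≤ ∂_y² e_K(S − Φ(e, y+θ))` and `|∂_y² e_K(S − Φ(e, y+θ))| ≤ L₂ := 2K₂msD₁² + w·u_min²`. -/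
theorem partnerBand_curvature_of_window {Kc r₀ g₀ w : ℝ} (hG : GeomConstants (frameLevel μ K) Kc r₀ g₀ w) (S : Momentum) (m : Fin 2 → ℤ)
    {e : ℝ} (he : |e| < r) (θ x₀ y : ℝ)
    (hwin : K₃ * (‖S - WithLp.toLp 2 (fun i => 2 * π * (m i : ℝ)) - (levelPoint μ K 0 (x₀ + θ) + levelPoint μ K 0 (x₀ + θ))‖ +
              |e| / ((bandBounds (show (-4 : ℝ) < -1.1 by norm_num) (show (-1.1 : ℝ) ≤ -0.1 by norm_num) (show (-0.1 : ℝ) < 0 by norm_num)).Dtmin - 2 * A) +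
              msD A₃ A₄ 1 * |y - x₀|) * msD A₃ A₄ 1 ^ 2 +
          K₂ * (radialRowOneConst A ((bandBounds (show (-4 : ℝ) < -1.1 by norm_num) (show (-1.1 : ℝ) ≤ -0.1 by norm_num) (show (-0.1 : ℝ) < 0 by norm_num)).Dtmin -
                2 * A) * |e| + msD A₃ A₄ 2 * |y - x₀|) * (msD A₃ A₄ 1 + msD A₃ A₄ 1) +
          K₂ * (‖S - WithLp.toLp 2 (fun i => 2 * π * (m i : ℝ)) - (levelPoint μ K 0 (x₀ + θ) + levelPoint μ K 0 (x₀ + θ))‖ +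
              |e| / ((bandBounds (show (-4 : ℝ) < -1.1 by norm_num) (show (-1.1 : ℝ) ≤ -0.1 by norm_num) (show (-0.1 : ℝ) < 0 by norm_num)).Dtmin - 2 * A) +
              msD A₃ A₄ 1 * |y - x₀|) * msD A₃ A₄ 2 +
          K₁ * ((uRowTwoConst A A₃ ((bandBounds (show (-4 : ℝ) < -1.1 by norm_num) (show (-1.1 : ℝ) ≤ -0.1 by norm_num) (show (-0.1 : ℝ) < 0 by norm_num)).Dtmin -
                  2 * A) +
                1 / ((bandBounds (show (-4 : ℝ) < -1.1 by norm_num) (show (-1.1 : ℝ) ≤ -0.1 by norm_num) (show (-0.1 : ℝ) < 0 by norm_num)).Dtmin - 2 * A) +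
                2 * (radialRowOneConst A ((bandBounds (show (-4 : ℝ) < -1.1 by norm_num) (show (-1.1 : ℝ) ≤ -0.1 by norm_num)
                    (show (-0.1 : ℝ) < 0 by norm_num)).Dtmin - 2 * A) -
                  1 / ((bandBounds (show (-4 : ℝ) < -1.1 by norm_num) (show (-1.1 : ℝ) ≤ -0.1 by norm_num) (show (-0.1 : ℝ) < 0 by norm_num)).Dtmin - 2 * A))) *
              |e| + msD A₃ A₄ 3 * |y - x₀|) ≤
        w * (bandBounds (show (-4 : ℝ) < -1.1 by norm_num) (show (-1.1 : ℝ) ≤ -0.1 by norm_num) (show (-0.1 : ℝ) < 0 by norm_num)).umin ^ 2) :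
    w * (bandBounds (show (-4 : ℝ) < -1.1 by norm_num) (show (-1.1 : ℝ) ≤ -0.1 by norm_num) (show (-0.1 : ℝ) < 0 by norm_num)).umin ^ 2 ≤
        iteratedDeriv 2 (fun x : ℝ => frameLevel μ K (S - levelPoint μ K e (x + θ))) y ∧
      |iteratedDeriv 2 (fun x : ℝ => frameLevel μ K (S - levelPoint μ K e (x + θ))) y| ≤
        2 * (K₂ * msD A₃ A₄ 1 ^ 2) +
          w * (bandBounds (show (-4 : ℝ) < -1.1 by norm_num) (show (-1.1 : ℝ) ≤ -0.1 by norm_num) (show (-0.1 : ℝ) < 0 by norm_num)).umin ^ 2 := by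
  have hfl := iteratedDeriv_two_partnerBand_pp_angle_ge_sheet hA hA20 hd hr hlo hhi hA₃ hA₄ hK₁ hK₂ hK₃ hG S m he θ x₀ y
  have hce := abs_iteratedDeriv_two_partnerBand_pp_angle_le_sheet hA hA20 hd hr hlo hhi hA₃ hA₄ hK₁ hK₂ hK₃ S m he θ x₀ y
  exact ⟨by linarith, by linarith⟩

omit hr hK₁ hK₃ in
/-- **FOLD POINTS AT EVERY LEVEL OF THE BOX (no implicit function).**  Window `[α,β] ∋ x₀` with margins `W_m ≤ x₀ − α`, `W_m ≤ β − x₀`; levels `|e| ≤ hi < r`; a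
curvature floor `c₂ > 0` on the box; and the slope budget `K₂msD₁·(dist₀ + 2hi/(Dt−2A)) ≤ c₂·W_m`, `dist₀ = ‖S − 2πm − 2Φ(0,x₀+θ)‖`.  THEN there is a choice of fold
points `v* : ℝ → ℝ` with `v*(e) ∈ [α,β]` and `∂_y e_K(S − Φ(e, ·+θ))(v*(e)) = 0` for every `|e| ≤ hi`. -/
theorem exists_foldPoints_partnerBand (S : Momentum) (m : Fin 2 → ℤ) (θ : ℝ) {α β x₀ Wm hi c₂ : ℝ} (hx₀ : x₀ ∈ Icc α β)
    (hWα : Wm ≤ x₀ - α) (hWβ : Wm ≤ β - x₀) (hhir : hi < r) (hc₂ : 0 < c₂)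
    (hfloor : ∀ e ∈ Icc (-hi) hi, ∀ y ∈ Icc α β, c₂ ≤ iteratedDeriv 2 (fun x : ℝ => frameLevel μ K (S - levelPoint μ K e (x + θ))) y)
    (hslope : K₂ * msD A₃ A₄ 1 * (‖S - WithLp.toLp 2 (fun i => 2 * π * (m i : ℝ)) - (2 : ℝ) • levelPoint μ K 0 (x₀ + θ)‖ +
        2 * (hi / ((bandBounds (show (-4 : ℝ) < -1.1 by norm_num) (show (-1.1 : ℝ) ≤ -0.1 by norm_num) (show (-0.1 : ℝ) < 0 by norm_num)).Dtmin - 2 * A))) ≤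
      c₂ * Wm) :
    ∃ vs : ℝ → ℝ, ∀ e ∈ Icc (-hi) hi, vs e ∈ Icc α β ∧ deriv (fun x : ℝ => frameLevel μ K (S - levelPoint μ K e (x + θ))) (vs e) = 0 := by
  set B := bandBounds (show (-4 : ℝ) < -1.1 by norm_num) (show (-1.1 : ℝ) ≤ -0.1 by norm_num) (show (-0.1 : ℝ) < 0 by norm_num) with hBdef
  have hADt : 2 * A < B.Dtmin := by have := klCurveD_pos; linarith
  have hDt : 0 < B.Dtmin - 2 * A := by linarith
  have hK₂0 : 0 ≤ K₂ := (norm_nonneg _).trans (hK₂ 0)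
  have hM := msD_one_pos A₃ A₄
  have heach : ∀ e ∈ Icc (-hi) hi, ∃ vs ∈ Icc α β, deriv (fun x : ℝ => frameLevel μ K (S - levelPoint μ K e (x + θ))) vs = 0 := by
    intro e he
    have her : |e| < r := abs_lt.2 ⟨by linarith [he.1], by linarith [he.2]⟩
    have hehi : |e| ≤ hi := abs_le.2 ⟨he.1, he.2⟩
    -- the slope at `x₀`
    have hs := abs_deriv_partnerBand_angle_le_caustic hA hA20 hd hlo hhi hA₃ hA₄ hK₂ S m her θ x₀
    have hD := norm_caustic_sub_two_smul_le hA hA20 hd hlo hhi hA₃ hA₄ S (WithLp.toLp 2 (fun i => 2 * π * (m i : ℝ))) her θ x₀ x₀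
    rw [sub_self, abs_zero, mul_zero, add_zero] at hD
    have hsmall : |deriv (fun x : ℝ => frameLevel μ K (S - levelPoint μ K e (x + θ))) x₀| ≤ c₂ * Wm := by
      refine hs.trans (le_trans ?_ hslope)
      refine mul_le_mul_of_nonneg_left (hD.trans ?_) (by positivity)
      have : |e| / (B.Dtmin - 2 * A) ≤ hi / (B.Dtmin - 2 * A) := div_le_div_of_nonneg_right hehi hDt.le
      linarith
    exact exists_foldPoint_of_slope_small (contDiff_partnerBand_angle hA hd hlo hhi S her θ) hx₀ (hfloor e he)
      (hsmall.trans (mul_le_mul_of_nonneg_left hWα hc₂.le)) (hsmall.trans (mul_le_mul_of_nonneg_left hWβ hc₂.le))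
  classical
  refine ⟨fun e => if h : e ∈ Icc (-hi) hi then Classical.choose (heach e h) else x₀, fun e he => ?_⟩
  simp only [he, dif_pos]
  exact (Classical.choose_spec (heach e he))

omit hr hK₁ hK₃ in
/-- **THE FOLD VALUE DRIFTS AT RATES IN `[1/2, 3/2]`** (monotonicity of the minimum; any choice of fold points).  Window `[α,β] ∋ x₀` with `|y − x₀| ≤ Wφ` on it;
levels `|e| ≤ hi < r`; fold points `v*(e) ∈ [α,β]` with vanishing slope and a nonnegative curvature on the box (so `v*(e)` minimises the level-`e` band on the
window); the RATE WINDOW `K₂·(dist₀ + 2(hi/(Dt−2A) + msD₁Wφ))/(Dt−2A) ≤ 1/2`.  THEN, with `δ₀ := e_K(S − Φ(0, v*(0)+θ))` (`= inf_{[α,β]}` of the level-0 band):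
for `0 ≤ e ≤ hi`, `δ₀ − (3/2)e ≤ g e (v* e) ≤ δ₀ − (1/2)e`; for `0 ≤ s ≤ hi`, `−δ₀ − (3/2)s ≤ −g (−s) (v*(−s)) ≤ −δ₀ − (1/2)s` (`g e y = e_K(S − Φ(e,y+θ))`) —
the `hdrift` rows of `…C4aFoldBoxTwoSidedLaw` / `…C4aFoldBoxPostLaw` with `λ₁ = 1/2`, `λ₂ = 3/2` on either side of the Fermi level. -/
theorem partnerBand_foldValue_drift (S : Momentum) (m : Fin 2 → ℤ) (θ : ℝ) {α β x₀ Wφ hi : ℝ} {vs : ℝ → ℝ}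
    (hWφ : ∀ y ∈ Icc α β, |y - x₀| ≤ Wφ) (hhi0 : 0 ≤ hi) (hhir : hi < r)
    (hvs : ∀ e ∈ Icc (-hi) hi, vs e ∈ Icc α β ∧ deriv (fun x : ℝ => frameLevel μ K (S - levelPoint μ K e (x + θ))) (vs e) = 0)
    (hconv : ∀ e ∈ Icc (-hi) hi, ∀ y ∈ Icc α β, 0 ≤ iteratedDeriv 2 (fun x : ℝ => frameLevel μ K (S - levelPoint μ K e (x + θ))) y)
    (hrate : K₂ * (‖S - WithLp.toLp 2 (fun i => 2 * π * (m i : ℝ)) - (2 : ℝ) • levelPoint μ K 0 (x₀ + θ)‖ +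
          2 * (hi / ((bandBounds (show (-4 : ℝ) < -1.1 by norm_num) (show (-1.1 : ℝ) ≤ -0.1 by norm_num) (show (-0.1 : ℝ) < 0 by norm_num)).Dtmin - 2 * A) +
            msD A₃ A₄ 1 * Wφ)) /
        ((bandBounds (show (-4 : ℝ) < -1.1 by norm_num) (show (-1.1 : ℝ) ≤ -0.1 by norm_num) (show (-0.1 : ℝ) < 0 by norm_num)).Dtmin - 2 * A) ≤ 1 / 2) :
    (∀ e ∈ Icc 0 hi,
        frameLevel μ K (S - levelPoint μ K 0 (vs 0 + θ)) - 3 / 2 * e ≤ frameLevel μ K (S - levelPoint μ K e (vs e + θ)) ∧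
          frameLevel μ K (S - levelPoint μ K e (vs e + θ)) ≤ frameLevel μ K (S - levelPoint μ K 0 (vs 0 + θ)) - 1 / 2 * e) ∧
      (∀ s ∈ Icc 0 hi,
        -frameLevel μ K (S - levelPoint μ K 0 (vs 0 + θ)) - 3 / 2 * s ≤ -frameLevel μ K (S - levelPoint μ K (-s) (vs (-s) + θ)) ∧
          -frameLevel μ K (S - levelPoint μ K (-s) (vs (-s) + θ)) ≤ -frameLevel μ K (S - levelPoint μ K 0 (vs 0 + θ)) - 1 / 2 * s) := by
  set B := bandBounds (show (-4 : ℝ) < -1.1 by norm_num) (show (-1.1 : ℝ) ≤ -0.1 by norm_num) (show (-0.1 : ℝ) < 0 by norm_num) with hBdef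
  set v : Momentum := WithLp.toLp 2 (fun i => 2 * π * (m i : ℝ)) with hv
  have hADt : 2 * A < B.Dtmin := by have := klCurveD_pos; linarith
  have hDt : 0 < B.Dtmin - 2 * A := by linarith
  have hK₂0 : 0 ≤ K₂ := (norm_nonneg _).trans (hK₂ 0)
  have h0r : |(0 : ℝ)| < r := by rw [abs_zero]; exact hhi0.trans_lt hhir
  have hM : 0 ≤ msD A₃ A₄ 1 := (norm_nonneg _).trans (norm_iteratedDeriv_levelPoint_le hA hA20 hd hlo hhi hA₃ hA₄ h0r le_rfl (by norm_num) 0)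
  have h0I : (0 : ℝ) ∈ Icc (-hi) hi := ⟨by linarith, hhi0⟩
  -- minimiser property at every level
  have hmin : ∀ e ∈ Icc (-hi) hi, ∀ y ∈ Icc α β,
      frameLevel μ K (S - levelPoint μ K e (vs e + θ)) ≤ frameLevel μ K (S - levelPoint μ K e (y + θ)) := fun e he y hy => by
    have her : |e| < r := abs_lt.2 ⟨by linarith [he.1], by linarith [he.2]⟩
    exact le_of_fold_of_convex (contDiff_partnerBand_angle hA hd hlo hhi S her θ) (hvs e he).1 (hvs e he).2 (hconv e he) hy
  -- the rate window at every loop angle of the window and all levels of `[−hi, hi]`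
  have hwin : ∀ y ∈ Icc α β, ∀ s ∈ Icc (-hi) hi, K₂ * ‖S - v - (2 : ℝ) • levelPoint μ K s (y + θ)‖ / (B.Dtmin - 2 * A) ≤ 1 / 2 := by
    intro y hy s hs
    have hsr : |s| < r := abs_lt.2 ⟨by linarith [hs.1], by linarith [hs.2]⟩
    have hshi : |s| ≤ hi := abs_le.2 ⟨hs.1, hs.2⟩
    have hD := norm_caustic_sub_two_smul_le hA hA20 hd hlo hhi hA₃ hA₄ S v hsr θ x₀ y
    refine le_trans ?_ hrate
    refine div_le_div_of_nonneg_right (mul_le_mul_of_nonneg_left (hD.trans ?_) hK₂0) hDt.le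
    have h1 : |s| / (B.Dtmin - 2 * A) ≤ hi / (B.Dtmin - 2 * A) := div_le_div_of_nonneg_right hshi hDt.le
    have h2 : msD A₃ A₄ 1 * |y - x₀| ≤ msD A₃ A₄ 1 * Wφ := mul_le_mul_of_nonneg_left (hWφ y hy) hM
    linarith
  -- rates between two levels `e' ≤ e` of `[−hi, hi]` at a loop angle of the window
  have hrates : ∀ y ∈ Icc α β, ∀ e' e : ℝ, -hi ≤ e' → e' ≤ e → e ≤ hi →
      -(3 / 2) * (e - e') ≤ frameLevel μ K (S - levelPoint μ K e (y + θ)) - frameLevel μ K (S - levelPoint μ K e' (y + θ)) ∧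
        frameLevel μ K (S - levelPoint μ K e (y + θ)) - frameLevel μ K (S - levelPoint μ K e' (y + θ)) ≤ -(1 / 2) * (e - e') :=
    fun y hy e' e h1 h2 h3 =>
      partnerBand_level_rate_window hA hd hlo hhi hK₂ (frameLevel_add_twoPi μ K m) S (y + θ) h2 (by linarith) (by linarith)
        fun s hs => hwin y hy s ⟨h1.trans hs.1, hs.2.trans h3⟩
  constructor
  · intro e he
    have heI : e ∈ Icc (-hi) hi := ⟨by linarith [he.1], he.2⟩
    constructor
    · -- lower: `g e (v* e) ≥ g 0 (v* e) − (3/2)e ≥ g 0 (v* 0) − (3/2)e`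
      have h1 := (hrates (vs e) (hvs e heI).1 0 e (by linarith) he.1 he.2).1
      have h2 := hmin 0 h0I (vs e) (hvs e heI).1
      linarith
    · -- upper: `g e (v* e) ≤ g e (v* 0) ≤ g 0 (v* 0) − (1/2)e`
      have h1 := (hrates (vs 0) (hvs 0 h0I).1 0 e (by linarith) he.1 he.2).2
      have h2 := hmin e heI (vs 0) (hvs 0 h0I).1
      linarith
  · intro s hs
    have hsI : -s ∈ Icc (-hi) hi := ⟨by linarith [hs.2], by linarith [hs.1]⟩
    constructor
    · -- `g (−s) (v*(−s)) ≤ g (−s) (v* 0) ≤ g 0 (v* 0) + (3/2)s`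
      have h1 := (hrates (vs 0) (hvs 0 h0I).1 (-s) 0 (by linarith [hs.2]) (by linarith [hs.1]) hhi0).1
      have h2 := hmin (-s) hsI (vs 0) (hvs 0 h0I).1
      linarith
    · -- `g (−s) (v*(−s)) ≥ g 0 (v*(−s)) + (1/2)s ≥ g 0 (v* 0) + (1/2)s`
      have h1 := (hrates (vs (-s)) (hvs (-s) hsI).1 (-s) 0 (by linarith [hs.2]) (by linarith [hs.1]) hhi0).2
      have h2 := hmin 0 h0I (vs (-s)) (hvs (-s) hsI).1
      linarith

end Sizes

end Summit.HubbardSuperconductivity.HubbardSuperconductivity.Theorems.C4a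

end
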